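import Summits.Ventures.CertifiedArithmetic.LowPrec.GemmWorstCaseE2M1
import Summits.Ventures.CertifiedArithmetic.LowPrec.GemmTieChainFamilies

/-!
# `W(n)` of E2M1²→bfloat16 is nondecreasing in `n`, and exceeds the low-trajectory value for all `n`

HONEST FRAMING (venture CertifiedArithmetic / cell `pub-lowprec`): certified error envelopes and
provably optimal rounding/accumulation schemes for low-precision formats under stated cost models;
every table by two implementations; no hardware or vendor claims.

Two structural facts about the defined maximum `worstRelErrE2M1BF16 m` (= the paper's `W(n)`,
`n = m + 1`, `GemmWorstCaseE2M1.lean`) that `gemm.tex` §Regimes uses without comment: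
* `worst_mono`, `worst_mono_of_le`: `W(n) ≤ W(n+1) ≤ …` — append the letter `0 ∈ Π` (a NULL
  absorption: the accumulator, the sum and the mass are unchanged; `relErr_extend_zero` holds in
  every format);
* `max_low_le_worst`: `max((n-2)/(286+n), (n-3)/(253+n)) ≤ W(n)` for every `n ≥ 3` — the two
  tie-chain families of `GemmTieChainFamilies.lean` are inputs of letters (the equality of
  `gemm.tex` Lemma `l:low` on the LOW inputs is `GemmLowTrajectoriesBound.low_trajectory_max`;
  here only the lower bound for the unrestricted `W`).
-/

namespace Literature.ComputerArithmetic.FloatingPoint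

namespace MiniFloat

open Finset Format

variable {α : Format}

/-! ### Appending a zero letter -/

/-- A trailing `0` changes nothing: `relErr x (m+1) = relErr x m` when `x (m+1) = 0`
(`fl(ŝ + 0) = ŝ`, the sum and the mass are unchanged). Every format. [folklore] -/
theorem relErr_extend_zero (x : ℕ → ℚ) (m : ℕ) (hx : x (m + 1) = 0) :
    relErr α x (m + 1) = relErr α x m := by
  unfold relErr
  have hstep : (seqSum α x (m + 1)).toRat = (seqSum α x m).toRat := by
    show (roundNE α ((seqSum α x m).toRat + x (m + 1))).toRat = _
    rw [hx, add_zero, toRat_roundNE_toRat]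
  rw [hstep, sum_range_succ x (m + 1), sum_range_succ (fun j => |x j|) (m + 1), hx, abs_zero,
    add_zero, add_zero]

/-- The word `w` of length `m+1` extended by the letter `0` (index `0` of `piE2M1`) spells the
same first `m+1` terms and then `0`. [cell] -/
theorem wordInput_extend_zero {m : ℕ} (w : Fin (m + 1) → Fin 37) :
    (∀ j ≤ m, wordInput (fun i : Fin (m + 2) => if h : i.val < m + 1 then w ⟨i.val, h⟩ else (0 : Fin 37)) j
        = wordInput w j) ∧
      wordInput (fun i : Fin (m + 2) => if h : i.val < m + 1 then w ⟨i.val, h⟩ else (0 : Fin 37)) (m + 1)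
        = 0 := by
  constructor
  · intro j hj
    unfold wordInput
    rw [dif_pos (show j < m + 2 by omega), dif_pos (show j < m + 1 by omega)]
    simp only [dif_pos (show j < m + 1 by omega)]
  · unfold wordInput
    rw [dif_pos (show m + 1 < m + 2 by omega)]
    simp only [lt_irrefl, dif_neg, not_false_eq_true]
    rfl

/-! ### Monotonicity of `W` -/

/-- `W(n) ≤ W(n+1)`: E2M1²→bfloat16, sequential, RNE. [cell, gemm.tex §Model] -/
theorem worst_mono (m : ℕ) : worstRelErrE2M1BF16 m ≤ worstRelErrE2M1BF16 (m + 1) := by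
  apply sup'_le
  intro w _
  obtain ⟨hpre, hlast⟩ := wordInput_extend_zero w
  have h1 : relErr Format.BFloat16 (wordInput w) m
      = relErr Format.BFloat16
          (wordInput (fun i : Fin (m + 2) => if h : i.val < m + 1 then w ⟨i.val, h⟩ else (0 : Fin 37))) m :=
    relErr_congr Format.BFloat16 (fun j hj => (hpre j hj).symm)
  rw [h1, ← relErr_extend_zero _ m hlast]
  exact relErr_le_worst _ (wordInput_mem _) (m + 1)

/-- `W` is nondecreasing: `W(m+1) ≤ W(m'+1)` for `m ≤ m'`. [cell, gemm.tex §Model] -/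
theorem worst_mono_of_le {m m' : ℕ} (h : m ≤ m') : worstRelErrE2M1BF16 m ≤ worstRelErrE2M1BF16 m' := by
  induction h with
  | refl => exact le_rfl
  | step _ ih => exact le_trans ih (worst_mono _)

/-! ### The low-trajectory value is a lower bound for every `n ≥ 3` -/

/-- `max((n-2)/(286+n), (n-3)/(253+n)) ≤ W(n)` for every `n = m + 1 ≥ 3`: both tie-chain families
are inputs of letters of `Π(E2M1,E2M1)`. [cell, gemm.tex Prop. p:sandwich (ii)] -/
theorem max_low_le_worst (m : ℕ) (hm : 2 ≤ m) :
    max (((m : ℚ) - 1) / (287 + m)) (((m : ℚ) - 2) / (254 + m)) ≤ worstRelErrE2M1BF16 m := by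
  have h72 := TieChain.bf16_72_ratio (m + 1) (by omega)
  have h64 := TieChain.bf16_64_ratio (m + 1) (by omega)
  rw [Nat.add_sub_cancel] at h72 h64
  have w72 := relErr_le_worst TieChain.bf16_72 TieChain.bf16_72_mem m
  have w64 := relErr_le_worst TieChain.bf16_64 TieChain.bf16_64_mem m
  unfold relErr at w72 w64
  rw [h72] at w72
  rw [h64] at w64
  push_cast at w72 w64
  have e1 : ((m : ℚ) - 1) / (287 + m) = ((m : ℚ) + 1 - 2) / (286 + ((m : ℚ) + 1)) := by ring_nf
  have e2 : ((m : ℚ) - 2) / (254 + m) = ((m : ℚ) + 1 - 3) / (253 + ((m : ℚ) + 1)) := by ring_nf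
  rw [e1, e2]
  exact max_le w72 w64

end MiniFloat

end Literature.ComputerArithmetic.FloatingPoint
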